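import Literature.AlgebraicGeometry.HodgeTheory.RationalClassesRingChange
import Mathlib.Analysis.Complex.Basic
import HarnessLib

/-!
# `Hᵏ(Y; R) → Hᵏ(Y; S)` is injective whenever `R → S` has an additive retraction; in particular
# `Hᵏ(Y; ℝ) → Hᵏ(Y; ℂ)` is injective

Family `hodge`, layer `Literature/AlgebraicGeometry/HodgeTheory`.  Companion to
`RationalClassesRingChange` (`ringChange_rat_injective`: `Hᵏ(Y; ℚ) → Hᵏ(Y; ℂ)` is injective), with
the SAME printed source and the same cochain-level proof, stated once for a general change of
coefficients `f : R → S` admitting an additive retraction `ρ : S → R` (`ρ ∘ f = id`), and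
specialised to `ℝ ⊂ ℂ` (retraction `Re`).  Hatcher, *Algebraic Topology* (2002), §3.1, Thm. 3.2 with
p. 198: over a field `F`, `Hᵏ(Y; F) = Hom(Hₖ(Y), F)`, so extension of scalars between fields is
injective on cohomology; on cochains: if `f ∘ ζ = δw` then `ζ = ρ ∘ f ∘ ζ = δ(ρ ∘ w)`
(`coboundary_comp_addMonoidHom`), and in degree `0` there are no coboundaries.  Everything PROVED;
no definition, no named fact.  Use (cell `hodge-kum4`, rung H3): transport of `Γ`-invariance and
of identities between real and complex cohomology of `X(ℂ)` in the `G`-signature route.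

* `ringChange_eq_zero_iff_of_retraction`, `ringChange_injective_of_retraction` — general `f`, `ρ`;
* `ringChange_real_eq_zero_iff`, `ringChange_real_injective` — `f = algebraMap ℝ ℂ`, `ρ = Re`.
-/

noncomputable section

open CategoryTheory

universe u v

namespace Literature.AlgebraicGeometry.HodgeTheory

section HodgeTheory

open Literature.AlgebraicTopology.SingularHomology singularCochainComplex

variable {Y : Type u} [TopologicalSpace Y] {k : ℕ}

/-- **`Hᵏ(Y; R) → Hᵏ(Y; S)` is injective for a change of rings `f : R → S` with an additive
retraction `ρ`** (`ρ (f r) = r`): `f_*(x) = 0 ↔ x = 0`.  Cochain proof as for `ℚ ⊂ ℂ`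
(`ringChange_rat_eq_zero_iff`): if `f ∘ ζ = δw` then `ζ = δ(ρ ∘ w)`.
[cite: HatcherAT2002, §3.1 Thm. 3.2 and p. 198] -/
theorem ringChange_eq_zero_iff_of_retraction {R S : Type v} [CommRing R] [CommRing S] (f : R →+* S)
    (ρ : S →+ R) (hρ : ∀ r : R, ρ (f r) = r) (x : singularCohomology R R Y k) :
    singularCohomology.ringChange f Y k x = 0 ↔ x = 0 := by
  refine ⟨fun hx ↦ ?_, fun hx ↦ by rw [hx, map_zero]⟩
  have hρf : ∀ φ : SingularSimplex Y k → R, ρ ∘ (f ∘ φ) = φ :=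
    fun φ ↦ funext fun σ ↦ hρ (φ σ)
  induction x using singularCohomology_induction_on with
  | h ζ =>
    rw [singularCohomology.ringChange_π, singularCohomology.π_eq_zero_iff_exists] at hx
    obtain ⟨w, hw⟩ := hx
    rw [← coFn_eq, coFn_cocyclesRingChange] at hw
    cases k with
    | zero =>
      rw [d_prev_zero_eq_zero] at hw
      have hζ : coFn ζ = 0 := by
        rw [← hρf (coFn ζ), ← hw]
        funext σ
        exact map_zero ρ
      rw [show ζ = 0 from coFn_injective (hζ.trans coFn_zero.symm), map_zero]
    | succ m =>
      obtain ⟨w', hw'⟩ := (exists_d_prev_succ_iff _).1 ⟨w, hw⟩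
      rw [singularCohomology.π_eq_zero_iff_exists]
      refine (exists_d_prev_succ_iff _).2 ⟨ρ ∘ w', ?_⟩
      rw [coboundary_comp_addMonoidHom, hw', hρf, coFn_eq]

/-- **Injectivity of `f_* : Hᵏ(Y; R) → Hᵏ(Y; S)`** under an additive retraction of `f`.
[cite: HatcherAT2002, §3.1 Thm. 3.2 and p. 198] -/
theorem ringChange_injective_of_retraction {R S : Type v} [CommRing R] [CommRing S] (f : R →+* S)
    (ρ : S →+ R) (hρ : ∀ r : R, ρ (f r) = r) :
    Function.Injective (singularCohomology.ringChange f Y k) :=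
  (injective_iff_map_eq_zero _).2 fun x ↦ (ringChange_eq_zero_iff_of_retraction f ρ hρ x).1

/-- **`Hᵏ(Y; ℝ) → Hᵏ(Y; ℂ)` is injective**: `ι(x) = 0 ↔ x = 0` (retraction `Re`).
[cite: HatcherAT2002, §3.1 Thm. 3.2 and p. 198] -/
theorem ringChange_real_eq_zero_iff (x : singularCohomology ℝ ℝ Y k) :
    singularCohomology.ringChange (algebraMap ℝ ℂ) Y k x = 0 ↔ x = 0 :=
  ringChange_eq_zero_iff_of_retraction (algebraMap ℝ ℂ) Complex.reAddGroupHom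
    (fun r ↦ Complex.ofReal_re r) x

/-- **`Hᵏ(Y; ℝ) → Hᵏ(Y; ℂ)` is injective.** [cite: HatcherAT2002, §3.1 Thm. 3.2 and p. 198] -/
theorem ringChange_real_injective :
    Function.Injective (singularCohomology.ringChange (algebraMap ℝ ℂ) Y k) :=
  ringChange_injective_of_retraction (algebraMap ℝ ℂ) Complex.reAddGroupHom
    fun r ↦ Complex.ofReal_re r

/-- Hence `ι(x) = ι(y) ↔ x = y` for real classes. [cite: HatcherAT2002, §3.1 Thm. 3.2 and p. 198] -/
theorem ringChange_real_eq_iff (x y : singularCohomology ℝ ℝ Y k) :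
    singularCohomology.ringChange (algebraMap ℝ ℂ) Y k x =
        singularCohomology.ringChange (algebraMap ℝ ℂ) Y k y ↔ x = y :=
  ringChange_real_injective.eq_iff

end HodgeTheory

end Literature.AlgebraicGeometry.HodgeTheory

end
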